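import Summits.QuantumFields.QCD.Theses.QuarksAsStableAction

/-!
# Projector-chain substitution for the time-sliced Wilson fermion matrix
(helper for crux stmt-QuantumFields-9737, line `Sketch` — F3-core brick, stub
`projChain_mul_shiftSubst`)

The "projector-chain substitution" step of the time-slice (Lüscher transfer-matrix) reduction of the
`r = 1` Wilson fermion matrix.  In time-block form the fermion matrix reads
`D = δ_{ts} A_t − δ_{s,t+1} P⁻ W_t − δ_{t,s+1} P⁺ W′_s` (slice operator `A_t`, forward temporal hop
`P⁻ W_t`, backward hop `P⁺ W′_s`), where `P± = (1 ± γ₀)/2` are complementary projections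
(`P⁺ + P⁻ = 1`, `P⁺ P⁻ = P⁻ P⁺ = 0`) commuting with the hops.  Substituting
`ψ_s = P⁻ φ_s + P⁺ φ_{s+1}` (the block matrix `Σ′ = δ_{us} P⁻ + δ_{u,s+1} P⁺`) makes `D · Σ′` block
*bidiagonal* cyclic, with diagonal blocks `E_t = A_t P⁻ − P⁺ W′_{t−1}` and super-diagonal blocks
`F_t = A_t P⁺ − P⁻ W_t`: the cross terms `P⁻ W_t P⁺`, `P⁺ W′_s P⁻` vanish by the projector relations,
uniformly in the number `T ≥ 1` of time slices (no mutual exclusivity of the Kronecker conditions is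
used, so the degenerate periods `T = 1, 2` are covered).
[cite: Luscher1977, pp. 283–292]; Smit, *Introduction to Quantum Fields on a Lattice*, §6.5 (prose
mention).  Pure matrix algebra over Mathlib; pure theorem file (no definitions).
-/

noncomputable section

namespace Summit.QuantumFields.QCD.Cruxes.StableActionBridge.Sketch

open Finset

namespace ProjChain

/-- **Block multiplication.**  If the time blocks `M t s`, `M' s u`, `R t u` (square matrices over the
inner index `k`) satisfy `Σ_s M_{ts} M'_{su} = R_{tu}` for all `t, u`, then the corresponding block
matrices over `ι × k` satisfy `M · M' = R`. -/
theorem of_blocks_mul_of_blocks {ι k : Type*} [Fintype ι] [Fintype k]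
    (M M' R : ι → ι → Matrix k k ℂ) (h : ∀ t u, ∑ s, M t s * M' s u = R t u) :
    ((Matrix.of fun p q : ι × k => M p.1 q.1 p.2 q.2) *
        Matrix.of fun p q : ι × k => M' p.1 q.1 p.2 q.2) =
      Matrix.of fun p q : ι × k => R p.1 q.1 p.2 q.2 := by
  ext ⟨t, i⟩ ⟨u, j⟩
  simp only [Matrix.mul_apply, Matrix.of_apply, Fintype.sum_prod_type, ← h, Matrix.sum_apply]

/-- **Block identity behind the projector-chain substitution.**  For complementary idempotents
`Pp, Pm` (`Pp Pm = Pm Pp = 0`) commuting with the hops `W t`, `W' t`, the time-block convolution of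
`D_{ts} = δ_{s=t} A_t − δ_{s=t+1} Pm W_t − δ_{t=s+1} Pp W'_s` with
`Σ′_{su} = δ_{u=s} Pm + δ_{u=s+1} Pp` is `δ_{u=t} (A_t Pm − Pp W'_{t−1}) + δ_{u=t+1} (A_t Pp − Pm W_t)`. -/
theorem sum_blocks_mul_shiftSubst_blocks {T : ℕ} [NeZero T] {k : Type*} [Fintype k]
    (A W W' : ZMod T → Matrix k k ℂ) (Pp Pm : Matrix k k ℂ)
    (hPp : Pp * Pp = Pp) (hPm : Pm * Pm = Pm) (hpm : Pp * Pm = 0) (hmp : Pm * Pp = 0)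
    (hWp : ∀ t, W t * Pp = Pp * W t) (hWm : ∀ t, W t * Pm = Pm * W t)
    (hW'p : ∀ t, W' t * Pp = Pp * W' t) (hW'm : ∀ t, W' t * Pm = Pm * W' t) (t u : ZMod T) :
    ∑ s, ((if s = t then A t else 0) - (if s = t + 1 then Pm * W t else 0) -
          (if t = s + 1 then Pp * W' s else 0)) *
        ((if u = s then Pm else 0) + (if u = s + 1 then Pp else 0)) =
      (if u = t then A t * Pm - Pp * W' (t - 1) else 0) +
        (if u = t + 1 then A t * Pp - Pm * W t else 0) := by
  have h2 : Pm * W t * Pm = Pm * W t := by rw [Matrix.mul_assoc, hWm, ← Matrix.mul_assoc, hPm]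
  have h2' : Pm * W t * Pp = 0 := by
    rw [Matrix.mul_assoc, hWp, ← Matrix.mul_assoc, hmp, zero_mul]
  have h3 : ∀ s, Pp * W' s * Pm = 0 := fun s => by
    rw [Matrix.mul_assoc, hW'm, ← Matrix.mul_assoc, hpm, zero_mul]
  have h3' : ∀ s, Pp * W' s * Pp = Pp * W' s := fun s => by
    rw [Matrix.mul_assoc, hW'p, ← Matrix.mul_assoc, hPp]
  have hts : ∀ s : ZMod T, (t = s + 1) = (s = t - 1) := fun s =>
    propext ⟨fun h => by rw [h, add_sub_cancel_right], fun h => by rw [h, sub_add_cancel]⟩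
  simp only [sub_mul, Finset.sum_sub_distrib, ite_mul, zero_mul, Finset.sum_ite_eq', Finset.mem_univ,
    if_true]
  simp only [mul_add, mul_ite, mul_zero, h2, h2', h3, h3', ite_self, add_zero, zero_add]
  simp only [hts, Finset.sum_ite_eq', Finset.mem_univ, if_true, sub_add_cancel]
  split_ifs <;> abel

end ProjChain

/-- **Projector-chain substitution** (stub `projChain_mul_shiftSubst` of line `Sketch`, F3-core brick):
for complementary projections `Pp + Pm = 1`, `Pp Pm = Pm Pp = 0` commuting with the temporal hops
`W t`, `W' t`, the time-block Wilson matrix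
`D = δ_{ts} A_t − δ_{s,t+1} Pm W_t − δ_{t,s+1} Pp W'_s` times the substitution matrix
`Σ′ = δ_{us} Pm + δ_{u,s+1} Pp` is the block-bidiagonal cyclic matrix with diagonal blocks
`A_t Pm − Pp W'_{t−1}` and super-diagonal blocks `A_t Pp − Pm W_t`. -/
theorem projChain_mul_shiftSubst :
    ∀ (T : ℕ) [NeZero T] (k : Type) [Fintype k] [DecidableEq k] (A W W' : ZMod T → Matrix k k ℂ)
      (Pp Pm : Matrix k k ℂ), Pp + Pm = 1 → Pp * Pm = 0 → Pm * Pp = 0 →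
      (∀ t, W t * Pp = Pp * W t) → (∀ t, W t * Pm = Pm * W t) →
      (∀ t, W' t * Pp = Pp * W' t) → (∀ t, W' t * Pm = Pm * W' t) →
        (Matrix.of fun p q : ZMod T × k =>
            (if q.1 = p.1 then A p.1 p.2 q.2 else 0) - (if q.1 = p.1 + 1 then (Pm * W p.1) p.2 q.2 else 0) -
              (if p.1 = q.1 + 1 then (Pp * W' q.1) p.2 q.2 else 0)) *
          (Matrix.of fun p q : ZMod T × k =>
            (if q.1 = p.1 then Pm p.2 q.2 else 0) + (if q.1 = p.1 + 1 then Pp p.2 q.2 else 0)) =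
        Matrix.of fun p q : ZMod T × k =>
          (if q.1 = p.1 then (A p.1 * Pm - Pp * W' (p.1 - 1)) p.2 q.2 else 0) +
            (if q.1 = p.1 + 1 then (A p.1 * Pp - Pm * W p.1) p.2 q.2 else 0) := by
  intro T _ k _ _ A W W' Pp Pm hsum hpm hmp hWp hWm hW'p hW'm
  have hPp : Pp * Pp = Pp := by
    have h := congrArg (fun X => Pp * X) hsum
    simpa only [mul_add, hpm, add_zero, mul_one] using h
  have hPm : Pm * Pm = Pm := by
    have h := congrArg (fun X => Pm * X) hsum
    simpa only [mul_add, hmp, zero_add, mul_one] using h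
  have h := ProjChain.of_blocks_mul_of_blocks (ι := ZMod T) (k := k)
    (fun t s => (if s = t then A t else 0) - (if s = t + 1 then Pm * W t else 0) -
      (if t = s + 1 then Pp * W' s else 0))
    (fun s u => (if u = s then Pm else 0) + (if u = s + 1 then Pp else 0))
    (fun t u => (if u = t then A t * Pm - Pp * W' (t - 1) else 0) +
      (if u = t + 1 then A t * Pp - Pm * W t else 0))
    (ProjChain.sum_blocks_mul_shiftSubst_blocks A W W' Pp Pm hPp hPm hpm hmp hWp hWm hW'p hW'm)
  simpa only [Matrix.sub_apply, Matrix.add_apply, Matrix.ite_apply, Matrix.zero_apply] using h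

end Summit.QuantumFields.QCD.Cruxes.StableActionBridge.Sketch

end
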